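import Summits.QuantumFields.BalabanUV.Beta.GAN24.DilatedBorderThirdJet
import Summits.QuantumFields.BalabanUV.Beta.GAN24.ThirdJetThreeKernel
import Summits.QuantumFields.BalabanUV.Beta.SecondOrderUnits

/-!
# `BalabanUV.Beta.GAN24.DecimatedKernelLegs` — binder row G-an2-4 / (CONV-C), S-slot («E3Shape» ∧ «E3SupRate»), road S3, DIFF row **R3-dV**
# (typer `LEAVES.md` v3.3 PART III § III.R, holder `b2b-balaban-gan24-formalise-leaf-03-g15`, INTENT «ROW-dV*» journal l.5224), part 4
# (generic `d`): THE LEG BLOCKS OF THE UNIT-RESCALED `Lc`-DECIMATED RESOLVENT `K♮ = D · dec Lc (KInv N′) · D`, `D = diag(Lc ∣ Lc^{d+1})`, and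
# the exact rewriting of member `n+3`'s depth-`(n−m)` border piece as member `n+2`'s three-leg functional at the kernel `K♮`

NOT IN PRINT; OUR BOOKKEEPING.  HONEST FRAMING (cell contract, verbatim): «discharging `BetaPertH` makes Bałaban's UV stability
UNCONDITIONAL — a real constructive-QFT result; it is NOT the continuum limit and NOT the Clay problem.»  HONEST DEPENDENCY (verbatim):
«continuum YM on T⁴ ⇐ BetaPertH ∧ nine spine estimates (0/9 proved); BetaPertH ⇐ (D1) ∧ (D4) ∧ CAP+tail; G-an2-4 gates asym, D1 and
NE2/3/4.»  [folklore] identities over the tree's definitions BY NAME — an4's `OneStepKernelFamily.dec`/`legSet`/`legW`/`legPt`/`KInvStep`, asym1's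
`HessKerDressedUnits.unitK`, an2's `OneStepResolventKernel.KInv` with its coarse pins, an4's `SecondOrderUnits.KInvStep_mm_eq_KInv_mm`, parts 1–2 of
this row (`DilatedBorderThirdJet.e3OfS_pushed_border_pow_succ`, `ThirdJetThreeKernel.e3K3_unitK_offdiag`); NO estimate, NO cited fact, NO `def`,
NO `def … : Prop`, NO wall binder; the reserved family `GAN24.StencilSlotE3*` is untouched.  Discharges NOTHING; NOT BetaPertH, NOT continuum, NOT Clay.

## What is proved (generic `d`; `N′ = Lc·N`; `K♮ := unitK Lc Lc^{d+1} (dec Lc (KInv N′))`)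
§1 THE FIVE LEG BLOCKS OF `K♮` that the off-diagonal third-jet functional reads (`ThreeKernelRowVBound.abs_entry3_le`'s hypotheses):
   `mm` row/column: `K♮ (N•x′) w _{mm} = Lc^{2(d+1)} · KInv N′ (N′•x′) (Lc•w)` (`unitK_dec_inr_inr`, `zsmul_zsmul_eq`); mixed blocks = `Lc`-BLOCK-CONTOUR
   sums: `K♮ x w (inr α) (inl l) = Lc^{d+2} Σ_{i ∈ legSet Lc (inl l)} legW · KInv N′ (Lc•x) (legPt Lc (inl l) w i)`, `K♮ u y (inl k) (inr l) = Lc^{d+2} Σ_i legW ·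
   KInv N′ (legPt Lc (inl k) u i) (Lc•y)`; at coarse arguments, with the tree's pins, the legs `GamΦ_{N′}` / `wH_{N′}` at the contour points
   (`unitK_dec_mf_coarse`, `unitK_dec_fm_coarse`) — in `N`-units these are the `Lc`-block-contour MEANS of member `n+3`'s normalised legs.
§2 `mm_coarse_eq_KStepUnit`: `N^{2(d+1)}·KInv N (N•x′) (N•z′)_{mm} = Lc^{2(d+1)} · K̃_j (Lc•x′) (Lc•z′)_{mm}`, `N = Lc^{j+1}`, `K̃_j = KStepUnit Lc j` — so the `mm`
   DIFFERENCE leg of two consecutive members is `Lc^{2(d+1)}` × a one-step difference of the K-slot's unit resolvents (`CauchyDecayK`'s object);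
   `KInv_inr_inr_of_proj_ne` (the `mm` block vanishes off the coarse lattice) and `proj_eq_zero_of_proj_zsmul` (lattice membership under `Lc•`).
§3 `decays_unitK_dec_KInv`: `K♮` decays (some rate, per `N′`; for the telescoping identity only).
§4 **`succ_piece_eq_e3K3_unitK`** — ROW dV's member-`(n+3)` side IN MEMBER-`(n+2)` FORM: with `W = (Lc^{d+1})^{n−m}·cVH·(Lc^{m+1})^{d+2}` (member `n+2`'s weight)
   and `T̂ = pushSum (Lc^{m+2}) (Lc^{n−m}) ∘ borderInc d Lc (Lc^{m+1})` (its table),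
   `(Lc^{n+3})^{2(d+1)} · e3OfS (Lc^{n+3}) (W′ • T′) κ′ u′ x z (inl α) (inl β) = (Lc^{n+2})^{2(d+1)} · e3K3 K♮ K♮ K♮ (Lc^{n+2}) (W • T̂) κ′ u′ x z (inl α) (inl β)`
   — part 1's identity, part 2's units covariance, and the arithmetic `Lc^{2(d+1)}·Lc^{d+2}·Lc^{d+2} = s_m²(s_f s_m)²`.
-/

noncomputable section

open Finset
open scoped BigOperators
open Literature.MathematicalPhysics.QuantumFieldTheory
open Literature.MathematicalPhysics.QuantumFieldTheory.Balaban1983to89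
open Literature.MathematicalPhysics.QuantumFieldTheory.Balaban1983to89.Beta
open Literature.Probability.LatticeModels (Torus.proj)
open LatticeForm (quo)
open B12Sec2to5 (l1 l1_nonneg)
open ExpKernelCalculus (MKer Decays)
open KernelSpecInstance (wH)
open KKTFluctuationKernel (GamΦ)
open OneStepResolventKernel (Fib LocStencil KInv decays_KInv proj_zsmul eq_zsmul_quo_of_proj KInv_inr_inl_coarse KInv_inl_inr_coarse)
open OneStepKernelFamily (dec legSet legW legPt KInvStep decays_dec')
open BalabanCompositeJets (pushSum borderInc)
open Summit.QuantumFields.BalabanUV.Beta.HessKerDressedUnits (unitK unitK_apply legScale_inl legScale_inr decays_unitK)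
open Summit.QuantumFields.BalabanUV.Beta.GAN24.CombesThomas (KStepUnit sfStep smStep)
open Summit.QuantumFields.BalabanUV.Beta.SecondOrderUnits (KInvStep_mm_eq_KInv_mm)
open Summit.QuantumFields.BalabanUV.Beta.GAN24.E3UnitSplit (e3OfS pushSum_borderInc_inl_inl pushSum_borderInc_inr_inr)
open Summit.QuantumFields.BalabanUV.Beta.GAN24.ThirdJetKernel (e3K)
open Summit.QuantumFields.BalabanUV.Beta.GAN24.ThirdJetThreeKernel (e3K3 e3K3_self e3K3_smul e3K3_unitK_offdiag)
open Summit.QuantumFields.BalabanUV.Beta.GAN24.DilatedBorderThirdJet (e3OfS_pushed_border_pow_succ)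

namespace Summit.QuantumFields.BalabanUV.Beta.GAN24.DecimatedKernelLegs

variable {d : ℕ} {Lc : ℕ} [NeZero Lc]

/-! ## §1 The leg blocks of `D · dec Lc K′ · D` -/

omit [NeZero Lc] in
/-- [folklore] Nested dilations: `Lc • (N • x) = (Lc·N) • x` with the casts of the rows. -/
theorem zsmul_zsmul_eq (N : ℕ) (x : Fin (d + 1) → ℤ) : (Lc : ℤ) • ((N : ℤ) • x) = (((Lc * N : ℕ) : ℤ)) • x := by
  rw [smul_smul, ← Nat.cast_mul]

omit [NeZero Lc] in
/-- [folklore] **THE `mm` BLOCK** of `D·dec Lc K′·D`: the two multiplier legs are read at the `Lc`-dilated points with unit `(Lc^{d+1})²`. -/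
theorem unitK_dec_inr_inr (K' : MKer (d + 1) (Fib d)) (x w : Fin (d + 1) → ℤ) (α β : Fin (d + 1)) :
    unitK (Lc : ℝ) ((Lc : ℝ) ^ (d + 1)) (dec Lc K') x w (Sum.inr α) (Sum.inr β) =
      (Lc : ℝ) ^ (2 * (d + 1)) * K' ((Lc : ℤ) • x) ((Lc : ℤ) • w) (Sum.inr α) (Sum.inr β) := by
  rw [unitK_apply, legScale_inr, legScale_inr]
  simp only [dec, legSet, legW, legPt, Finset.sum_singleton, one_mul]
  ring

omit [NeZero Lc] in
/-- [folklore] **THE `mf` BLOCK** (multiplier row, field column): the field leg is the `Lc`-block-contour sum with the decimation weights,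
unit `Lc^{d+1}·Lc`. -/
theorem unitK_dec_inr_inl (K' : MKer (d + 1) (Fib d)) (x w : Fin (d + 1) → ℤ) (α l : Fin (d + 1)) :
    unitK (Lc : ℝ) ((Lc : ℝ) ^ (d + 1)) (dec Lc K') x w (Sum.inr α) (Sum.inl l) =
      (Lc : ℝ) ^ (d + 2) * ∑ i ∈ legSet d Lc (Sum.inl l : Fib d), legW d Lc (Sum.inl l : Fib d) *
        K' ((Lc : ℤ) • x) (legPt Lc (Sum.inl l : Fib d) w i) (Sum.inr α) (Sum.inl l) := by
  have h : dec Lc K' x w (Sum.inr α) (Sum.inl l) = ∑ i ∈ legSet d Lc (Sum.inl l : Fib d), legW d Lc (Sum.inl l : Fib d) *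
      K' ((Lc : ℤ) • x) (legPt Lc (Sum.inl l : Fib d) w i) (Sum.inr α) (Sum.inl l) := by
    simp only [dec, legSet, Finset.sum_singleton]
    refine Finset.sum_congr rfl fun i _ => ?_
    simp only [legW, legPt, one_mul]
  rw [unitK_apply, legScale_inr, legScale_inl, h]
  ring

omit [NeZero Lc] in
/-- [folklore] **THE `fm` BLOCK** (field row, multiplier column): the field leg is the `Lc`-block-contour sum, unit `Lc·Lc^{d+1}`. -/
theorem unitK_dec_inl_inr (K' : MKer (d + 1) (Fib d)) (u y : Fin (d + 1) → ℤ) (k l : Fin (d + 1)) :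
    unitK (Lc : ℝ) ((Lc : ℝ) ^ (d + 1)) (dec Lc K') u y (Sum.inl k) (Sum.inr l) =
      (Lc : ℝ) ^ (d + 2) * ∑ i ∈ legSet d Lc (Sum.inl k : Fib d), legW d Lc (Sum.inl k : Fib d) *
        K' (legPt Lc (Sum.inl k : Fib d) u i) ((Lc : ℤ) • y) (Sum.inl k) (Sum.inr l) := by
  have h : dec Lc K' u y (Sum.inl k) (Sum.inr l) = ∑ i ∈ legSet d Lc (Sum.inl k : Fib d), legW d Lc (Sum.inl k : Fib d) *
      K' (legPt Lc (Sum.inl k : Fib d) u i) ((Lc : ℤ) • y) (Sum.inl k) (Sum.inr l) := by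
    simp only [dec, legSet, Finset.sum_singleton]
    refine Finset.sum_congr rfl fun i _ => ?_
    simp only [legW, legPt, mul_one]
  rw [unitK_apply, legScale_inr, legScale_inl, h]
  ring

omit [NeZero Lc] in
/-- [folklore] **THE `mf` BLOCK AT A COARSE ROW ARGUMENT, `K′ = KInv N′`, `N′ = Lc·N`**: the `Lc`-block-contour sum of the level-`N′` leg `GamΦ_{N′}`
(`KInv_inr_inl_coarse`). -/
theorem unitK_dec_mf_coarse {N N' : ℕ} [NeZero N'] (hN : N' = Lc * N) (x' w : Fin (d + 1) → ℤ) (α l : Fin (d + 1)) :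
    unitK (Lc : ℝ) ((Lc : ℝ) ^ (d + 1)) (dec Lc (KInv (N := N') (d := d))) ((N : ℤ) • x') w (Sum.inr α) (Sum.inl l) =
      (Lc : ℝ) ^ (d + 2) * ∑ i ∈ legSet d Lc (Sum.inl l : Fib d), legW d Lc (Sum.inl l : Fib d) *
        GamΦ (N := N') α x' l (legPt Lc (Sum.inl l : Fib d) w i) := by
  rw [unitK_dec_inr_inl]
  congr 1
  refine Finset.sum_congr rfl fun i _ => ?_
  rw [zsmul_zsmul_eq, ← hN, KInv_inr_inl_coarse]

omit [NeZero Lc] in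
/-- [folklore] **THE `fm` BLOCK AT A COARSE COLUMN ARGUMENT, `K′ = KInv N′`, `N′ = Lc·N`**: the `Lc`-block-contour sum of the level-`N′` minimiser
column `wH_{N′}` (`KInv_inl_inr_coarse`). -/
theorem unitK_dec_fm_coarse {N N' : ℕ} [NeZero N'] (hN : N' = Lc * N) (u u' : Fin (d + 1) → ℤ) (k l : Fin (d + 1)) :
    unitK (Lc : ℝ) ((Lc : ℝ) ^ (d + 1)) (dec Lc (KInv (N := N') (d := d))) u ((N : ℤ) • u') (Sum.inl k) (Sum.inr l) =
      (Lc : ℝ) ^ (d + 2) * ∑ i ∈ legSet d Lc (Sum.inl k : Fib d), legW d Lc (Sum.inl k : Fib d) *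
        wH (N := N') k l (legPt Lc (Sum.inl k : Fib d) u i - (N' : ℤ) • u') := by
  rw [unitK_dec_inl_inr]
  congr 1
  refine Finset.sum_congr rfl fun i _ => ?_
  rw [zsmul_zsmul_eq, ← hN, KInv_inl_inr_coarse]

omit [NeZero Lc] in
/-- [folklore] **THE `mm` ROW BLOCK AT A COARSE ROW ARGUMENT**: `K♮ (N•x′) w _{mm} = Lc^{2(d+1)} · KInv N′ (N′•x′) (Lc•w)`. -/
theorem unitK_dec_mm_coarse_left {N N' : ℕ} [NeZero N'] (hN : N' = Lc * N) (x' w : Fin (d + 1) → ℤ) (α β : Fin (d + 1)) :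
    unitK (Lc : ℝ) ((Lc : ℝ) ^ (d + 1)) (dec Lc (KInv (N := N') (d := d))) ((N : ℤ) • x') w (Sum.inr α) (Sum.inr β) =
      (Lc : ℝ) ^ (2 * (d + 1)) * KInv (N := N') (d := d) ((N' : ℤ) • x') ((Lc : ℤ) • w) (Sum.inr α) (Sum.inr β) := by
  rw [unitK_dec_inr_inr, zsmul_zsmul_eq, ← hN]

omit [NeZero Lc] in
/-- [folklore] **THE `mm` COLUMN BLOCK AT A COARSE COLUMN ARGUMENT**: `K♮ y (N•z′) _{mm} = Lc^{2(d+1)} · KInv N′ (Lc•y) (N′•z′)`. -/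
theorem unitK_dec_mm_coarse_right {N N' : ℕ} [NeZero N'] (hN : N' = Lc * N) (y z' : Fin (d + 1) → ℤ) (α β : Fin (d + 1)) :
    unitK (Lc : ℝ) ((Lc : ℝ) ^ (d + 1)) (dec Lc (KInv (N := N') (d := d))) y ((N : ℤ) • z') (Sum.inr α) (Sum.inr β) =
      (Lc : ℝ) ^ (2 * (d + 1)) * KInv (N := N') (d := d) ((Lc : ℤ) • y) ((N' : ℤ) • z') (Sum.inr α) (Sum.inr β) := by
  rw [unitK_dec_inr_inr, zsmul_zsmul_eq, ← hN]

/-! ## §2 The `mm` legs at coarse points are the K-slot's unit resolvents; lattice membership under `Lc•` -/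

/-- [folklore] **THE `mm` LEG AT COARSE POINTS IS THE K-SLOT's UNIT RESOLVENT**: `N^{2(d+1)}·KInv N (N•x′) (N•z′)_{mm} =
Lc^{2(d+1)} · (KStepUnit Lc j) (Lc•x′) (Lc•z′)_{mm}`, `N = Lc^{j+1}` (`SecondOrderUnits.KInvStep_mm_eq_KInv_mm`, `StencilSlotE3PhiLeg.pow_N_eq`'s arithmetic). -/
theorem mm_coarse_eq_KStepUnit (j : ℕ) (x' z' : Fin (d + 1) → ℤ) (α β : Fin (d + 1)) :
    ((Lc : ℝ) ^ (j + 1)) ^ (2 * (d + 1)) *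
        KInv (N := Lc ^ (j + 1)) (d := d) (((Lc ^ (j + 1) : ℕ) : ℤ) • x') (((Lc ^ (j + 1) : ℕ) : ℤ) • z') (Sum.inr α) (Sum.inr β) =
      (Lc : ℝ) ^ (2 * (d + 1)) * KStepUnit (d := d) Lc j ((Lc : ℤ) • x') ((Lc : ℤ) • z') (Sum.inr α) (Sum.inr β) := by
  show _ = (Lc : ℝ) ^ (2 * (d + 1)) * unitK (sfStep Lc j) (smStep d Lc j) (KInvStep (d := d) Lc j) ((Lc : ℤ) • x') ((Lc : ℤ) • z')
    (Sum.inr α) (Sum.inr β)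
  rw [unitK_apply, legScale_inr, legScale_inr, KInvStep_mm_eq_KInv_mm]
  simp only [smStep]
  have e : ((Lc : ℝ) ^ (j + 1)) ^ (2 * (d + 1)) = (Lc : ℝ) ^ (2 * (d + 1)) * ((Lc : ℝ) ^ (j * (d + 1)) * (Lc : ℝ) ^ (j * (d + 1))) := by
    rw [← pow_mul, ← pow_add, ← pow_add]; congr 1; ring
  rw [e]; ring

omit [NeZero Lc] in
/-- [folklore] The `mm` block of the one-shot resolvent vanishes off the coarse lattice (second argument). -/
theorem KInv_inr_inr_of_proj_ne {N : ℕ} [NeZero N] (x w : Fin (d + 1) → ℤ) (hw : Torus.proj N w ≠ 0) (α β : Fin (d + 1)) :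
    KInv (N := N) (d := d) x w (Sum.inr α) (Sum.inr β) = 0 := by
  simp only [KInv, hw, and_false, if_false]

omit [NeZero Lc] in
/-- [folklore] The `mm` block of the one-shot resolvent vanishes off the coarse lattice (first argument). -/
theorem KInv_inr_inr_of_proj_ne_left {N : ℕ} [NeZero N] (y z : Fin (d + 1) → ℤ) (hy : Torus.proj N y ≠ 0) (α β : Fin (d + 1)) :
    KInv (N := N) (d := d) y z (Sum.inr α) (Sum.inr β) = 0 := by
  simp only [KInv, hy, false_and, if_false]

/-- [folklore] **LATTICE MEMBERSHIP UNDER `Lc•`**: if `Lc•w` lies on the `(Lc·N)`-lattice then `w` lies on the `N`-lattice. -/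
theorem proj_eq_zero_of_proj_zsmul {N N' : ℕ} [NeZero N] [NeZero N'] (hN : N' = Lc * N) {w : Fin (d + 1) → ℤ}
    (h : Torus.proj N' ((Lc : ℤ) • w) = 0) : Torus.proj N w = 0 := by
  have e := eq_zsmul_quo_of_proj (N := N') h
  rw [hN] at e
  have e2 : (Lc : ℤ) • w = (Lc : ℤ) • ((N : ℤ) • quo (Lc * N) ((Lc : ℤ) • w)) := by
    rw [smul_smul]; push_cast at e; exact e
  have hLc : (Lc : ℤ) ≠ 0 := by exact_mod_cast NeZero.ne Lc
  have e3 : w = (N : ℤ) • quo (Lc * N) ((Lc : ℤ) • w) := smul_right_injective _ hLc e2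
  rw [e3]
  exact proj_zsmul (N := N) _

/-! ## §3 Decay of `K♮` (per `N′`; used only for the telescoping IDENTITY) -/

/-- [folklore] `K♮ = D·dec Lc (KInv N′)·D` decays exponentially (some rate and constant, per `N′`): `decays_KInv` ∘ `decays_dec'` ∘ `decays_unitK`. -/
theorem decays_unitK_dec_KInv {N' : ℕ} [NeZero N'] :
    ∃ δ C : ℝ, 0 < δ ∧ 0 ≤ C ∧ Decays (unitK (Lc : ℝ) ((Lc : ℝ) ^ (d + 1)) (dec Lc (KInv (N := N') (d := d)))) C δ := by
  have hLc1 : 1 ≤ Lc := Nat.one_le_iff_ne_zero.2 (NeZero.ne Lc)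
  obtain ⟨δ, C, hδ, hC, hK⟩ := decays_dec' (decays_KInv (N := N') (d := d)) hLc1
  exact ⟨δ, _, hδ, by positivity, decays_unitK (sf := (Lc : ℝ)) (sm := (Lc : ℝ) ^ (d + 1)) hK⟩

/-! ## §4 Member `n+3`'s piece as member `n+2`'s three-leg functional at the kernel `K♮` -/

/-- [folklore] **`succ_piece_eq_e3K3_unitK` — ROW dV's MEMBER-`(n+3)` SIDE IN MEMBER-`(n+2)` FORM** (exact; generic `d`, `1 ≤ Lc`): with member
`n+2`'s weight `W` and table `T̂` (the literal arguments of the END's `dV`, member-`(n+2)` summand) and `K♮ = unitK Lc Lc^{d+1} (dec Lc (KInv (Lc^{n+3})))`,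
`(Lc^{n+3})^{2(d+1)}·e3OfS (Lc^{n+3}) (W′ • T′) κ′ u′ x z a b = (Lc^{n+2})^{2(d+1)}·e3K3 K♮ K♮ K♮ (Lc^{n+2}) (W • T̂) κ′ u′ x z a b`. -/
theorem succ_piece_eq_e3K3_unitK (hLc : 1 ≤ Lc) (cVH : ℝ) (n m : ℕ) (κ' : Fin (d + 1)) (u' x z : Fin (d + 1) → ℤ) (a b : Fib d) :
    ((Lc : ℝ) ^ (n + 1 + 1 + 1)) ^ (2 * (d + 1)) *
        e3OfS (Lc ^ (n + 1 + 1 + 1))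
          (fun κ u => ((((Lc : ℝ) ^ (d + 1)) ^ (n - m) * (cVH * ((Lc : ℝ) ^ (m + 1 + 1)) ^ (d + 2))) •
            pushSum (Lc ^ (m + 1 + 1 + 1)) (Lc ^ (n - m)) (borderInc d Lc (Lc ^ (m + 1 + 1)) κ u))) κ' u' x z a b =
      ((Lc : ℝ) ^ (n + 1 + 1)) ^ (2 * (d + 1)) *
        e3K3 (unitK (Lc : ℝ) ((Lc : ℝ) ^ (d + 1)) (dec Lc (KInv (N := Lc ^ (n + 1 + 1 + 1)) (d := d))))
          (unitK (Lc : ℝ) ((Lc : ℝ) ^ (d + 1)) (dec Lc (KInv (N := Lc ^ (n + 1 + 1 + 1)) (d := d))))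
          (unitK (Lc : ℝ) ((Lc : ℝ) ^ (d + 1)) (dec Lc (KInv (N := Lc ^ (n + 1 + 1 + 1)) (d := d)))) (Lc ^ (n + 1 + 1))
          (fun κ u => ((((Lc : ℝ) ^ (d + 1)) ^ (n - m) * (cVH * ((Lc : ℝ) ^ (m + 1)) ^ (d + 2))) •
            pushSum (Lc ^ (m + 1 + 1)) (Lc ^ (n - m)) (borderInc d Lc (Lc ^ (m + 1)) κ u))) κ' u' x z a b := by
  have hL0 : (Lc : ℝ) ≠ 0 := by exact_mod_cast NeZero.ne Lc
  have hsf : (Lc : ℝ) ≠ 0 := hL0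
  have hsm : (Lc : ℝ) ^ (d + 1) ≠ 0 := pow_ne_zero _ hL0
  rw [e3OfS_pushed_border_pow_succ (d := d) hLc n m _ κ' u', ← e3K3_self,
    e3K3_unitK_offdiag hsf hsm _ _ _ _ _ (fun κ u x z α' β' => by
        simp only [Pi.smul_apply, smul_eq_mul, pushSum_borderInc_inl_inl, mul_zero])
      (fun κ u x z μ ν => by simp only [Pi.smul_apply, smul_eq_mul, pushSum_borderInc_inr_inr, mul_zero]),
    e3K3_smul, e3K3_smul]
  simp only [Pi.smul_apply, smul_eq_mul]
  ring

end Summit.QuantumFields.BalabanUV.Beta.GAN24.DecimatedKernelLegs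

end
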